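import Summits.ABC.ABC.Theorems.TwistAmplificationSharpModerateLawCoreInverseDictionaryFibres
import Summits.ABC.ABC.Theorems.TwistAmplificationSharpModerateLawCoreInverseDictionaryDescaling
import Summits.ABC.ABC.Theorems.TwistAmplificationSharpModerateLawCoreDefs
import Summits.ABC.ABC.Theorems.TwistAmplificationSharpModerateLawCoreTransfer
import Summits.ABC.ABC.Theorems.TwistAmplificationSharpModerateLawSyzygyTransfer

/-!
# Crux `TwistAmplification.SharpModerateLaw` (stmt-ABC-1975), line `unit-plane-conic-two-torsion`:
the inverse dictionary `CoreLaw → CoreLawIF`, III — counting and the cone bookkeeping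

Support file (`--supports stmt-ABC-1975`, stub `stub_ringCensus`, wave 2; the stub itself stays open), third of three.
The lead's Szpiro-robust canonical cores (`…SharpModerateLawCoreDefs.lean`): `CoreLaw` (cusp side: `#cuspShell X Y`,
tower-free pairs `(c₄, c₆)`, `1728 ∣ c₄³ − c₆² ≠ 0`, dyadic level, `N5cusp ≤ X`) and `CoreLawIF` (index-form side:
`totalCount ⊤ X Y`, data `q` of maximal orbit representatives in `ifShell`), both on `X^{κ₀} ≤ Y ≤ X^σ`, `3 < κ₀ < σ`.
The companion worker proves `CoreLawIF → CoreLaw` (through the landed dictionary `ncard_cuspShell_le`); this file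
closes the circle: **`coreLawIF_of_coreLaw : CoreLaw → CoreLawIF`** (registered sub-goal), so the census lines'
residue is not stronger than the canonical core.

* `totalCount_le_sum_cuspShell` — **`totalCount ⊤ X Y ≤ 27 · Σ_{s,t ≤ 2} #cuspShell X (16Y/(2^s3^t)¹²)`**: the data
  are modelled by a `Finset` of triples `(D, O, q)` as in `ncard_cuspShell_le` (`…SyzygyTransfer.lean`), mapped to
  their descaled cusp images (`exists_cusp_image`, `…CoreInverseDictionaryDescaling.lean`); a fibre consists of data
  with the same `(H_F(q), G_F(q))`, hence (maximality) the same `(D, O)` (`sigma_eq_of_data`) and at most `27` values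
  of `q` (`ncard_data_le`, `…CoreInverseDictionaryFibres.lean`); `Finset.card_le_mul_card_image`.
* `level_bound`, `coreLawIF_of_coreLaw` — use `CoreLaw` at `(κ₁, σ + 1)`, `κ₁ = (3 + κ₀)/2`: the nine levels
  `L ∈ [Y/c, 16Y]`, `c = 36¹²/16`, satisfy `X^{κ₁} ≤ L ≤ X^{σ+1}` once `X ≥ max(c^{1/(κ₀−κ₁)}, 16)`, with losses
  `16^ε·c^{1/6}` in the constant; for smaller `X` the level `Y ≤ X^σ` is bounded and the nine shells lie in a fixed
  finite box (`box_finite`, `…CoreTransfer.lean`).  Constant: `243·K + 243·max(C₀,0)·16^ε·c^{1/6}`.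
-/

noncomputable section

-- the mandated summit namespace `Summit.ABC.ABC` (summit = problem) trips the duplicate-namespace linter
set_option linter.dupNamespace false

namespace Summit.ABC.ABC.Theorems.SharpModerateLaw

open Literature.NumberTheory.CubicFields BinaryCubic
open scoped BigOperators

/-! ## 5. Counting: `totalCount ⊤ X Y ≤ 27 · Σ_{s,t ≤ 2} #cuspShell X (16Y/(2^s3^t)¹²)` -/

/-- The counted shell set of an orbit representative is finite (for `D ≠ 0`; `finite_mplus_le`). -/
theorem shellSet_finite' {D : ℤ} (hD : D ≠ 0) (O : orbitsOfDisc D) (X Y : ℝ) :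
    {q : ℤ × ℤ | RingOfForm.IsMaximal (orbitRep O) ∧ q ∈ ifShell (orbitRep O) X Y ∧ True}.Finite := by
  -- adapted from `shellSet_finite` (…SyzygyTransfer.lean)
  refine (finite_mplus_le (orbitRep O) (by rw [(orbitRep_spec O).2]; exact hD) ⌈2 * Y⌉₊).subset ?_
  rintro q ⟨-, hq, -⟩
  exact_mod_cast (show (Mplus (orbitRep O) q : ℝ) ≤ ⌈2 * Y⌉₊ from (le_of_lt hq.2.2.2.2.2.1).trans (Nat.le_ceil _))

/-- **The `27`-to-`1` map into the nine cusp shells**: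
`totalCount ⊤ X Y ≤ 27 · Σ_{s,t ≤ 2} #cuspShell X (16Y/(2^s3^t)¹²)` (`exists_cusp_image` for the image,
`sigma_eq_of_data` and `ncard_data_le` for the fibres). -/
theorem totalCount_le_sum_cuspShell (X Y : ℝ) :
    totalCount (fun _ _ _ _ => True) X Y ≤
      27 * ∑ ij ∈ Finset.range 3 ×ˢ Finset.range 3, (cuspShell X (16 * Y / ((2 : ℝ) ^ ij.1 * 3 ^ ij.2) ^ 12)).ncard := by
  classical
  -- a total choice of cusp images
  have himg : ∀ (F : BinaryCubic ℤ) (q : ℤ × ℤ), ∃ ij : ℕ × ℕ, ∃ x : ℤ × ℤ,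
      RingOfForm.IsMaximal F → q ∈ ifShell F X Y →
        ij ∈ Finset.range 3 ×ˢ Finset.range 3 ∧ 16 * hessAt F q.1 q.2 = ((2 : ℤ) ^ ij.1 * 3 ^ ij.2) ^ 4 * x.1 ∧
        -32 * covAt F q.1 q.2 = ((2 : ℤ) ^ ij.1 * 3 ^ ij.2) ^ 6 * x.2 ∧
        x ∈ cuspShell X (16 * Y / ((2 : ℝ) ^ ij.1 * 3 ^ ij.2) ^ 12) := by
    intro F q
    by_cases h : RingOfForm.IsMaximal F ∧ q ∈ ifShell F X Y
    · obtain ⟨ij, hij, x, h1, h2, h3⟩ := exists_cusp_image h.1 h.2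
      exact ⟨ij, x, fun _ _ => ⟨hij, h1, h2, h3⟩⟩
    · exact ⟨(0, 0), (0, 0), fun h1 h2 => absurd ⟨h1, h2⟩ h⟩
  choose ij xc hspec using himg
  -- `Finset` models of the orbits of discriminant `D ≠ 0` and of the counted shell sets (as in `ncard_cuspShell_le`)
  obtain ⟨orbFin, horb⟩ : ∃ f : (D : ℤ) → Finset (orbitsOfDisc D), ∀ D, D ≠ 0 → ∀ O, O ∈ f D :=
    ⟨fun D => if hD : D = 0 then ∅ else (@Set.finite_univ (orbitsOfDisc D) (finite_orbitsOfDisc hD)).toFinset,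
      fun D hD O => by simp only [dif_neg hD, Set.Finite.mem_toFinset, Set.mem_univ]⟩
  obtain ⟨shellFin, hcard, hmemS⟩ : ∃ g : (D : ℤ) → orbitsOfDisc D → Finset (ℤ × ℤ),
      (∀ D, D ≠ 0 → ∀ O, shellCount (fun _ _ _ _ => True) X Y (orbitRep O) = (g D O).card) ∧
      (∀ D (_ : D ≠ 0) O q, q ∈ g D O → RingOfForm.IsMaximal (orbitRep O) ∧ q ∈ ifShell (orbitRep O) X Y) :=
    ⟨fun D O => if hD : D = 0 then ∅ else (shellSet_finite' hD O X Y).toFinset,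
      fun D hD O => by simp only [dif_neg hD]; exact Set.ncard_eq_toFinset_card _ (shellSet_finite' hD O X Y),
      fun D hD O q h => by
        simp only [dif_neg hD, Set.Finite.mem_toFinset, Set.mem_setOf_eq] at h; exact ⟨h.1, h.2.1⟩⟩
  let U : Finset (Σ D : ℤ, Σ _ : orbitsOfDisc D, ℤ × ℤ) :=
    ((Finset.Icc (-(⌈2 * Y⌉₊ : ℤ)) (⌈2 * Y⌉₊ : ℤ)).erase 0).sigma fun D => (orbFin D).sigma fun O => shellFin D O
  have hU : U.card = totalCount (fun _ _ _ _ => True) X Y := by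
    rw [Finset.card_sigma]; unfold totalCount
    refine Finset.sum_congr rfl fun D hD => ?_
    have hD0 : D ≠ 0 := (Finset.mem_erase.mp hD).1
    rw [Finset.card_sigma]; unfold orbitTotal
    rw [finsum_eq_finsetSum_of_support_subset _ (fun O _ => Finset.mem_coe.mpr (horb D hD0 O))]
    exact Finset.sum_congr rfl fun O _ => (hcard D hD0 O).symm
  have hmemU : ∀ s ∈ U, RingOfForm.IsMaximal (orbitRep s.2.1) ∧ s.2.2 ∈ ifShell (orbitRep s.2.1) X Y := by
    intro s hs
    obtain ⟨hD, hs'⟩ := Finset.mem_sigma.mp hs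
    obtain ⟨-, hq⟩ := Finset.mem_sigma.mp hs'
    exact hmemS s.1 (Finset.mem_erase.mp hD).1 s.2.1 s.2.2 hq
  -- the map
  let Φ : (Σ D : ℤ, Σ _ : orbitsOfDisc D, ℤ × ℤ) → (ℕ × ℕ) × (ℤ × ℤ) := fun s =>
    (ij (orbitRep s.2.1) s.2.2, xc (orbitRep s.2.1) s.2.2)
  -- fibres have at most `27` elements
  have hfib : ∀ b ∈ U.image Φ, (U.filter (fun s => Φ s = b)).card ≤ 27 := by
    intro b hb
    obtain ⟨s₀, hs₀, rfl⟩ := Finset.mem_image.mp hb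
    obtain ⟨hmax₀, hsh₀⟩ := hmemU s₀ hs₀
    obtain ⟨-, h1₀, h2₀, -⟩ := hspec _ _ hmax₀ hsh₀
    set A := U.filter (fun s => Φ s = Φ s₀) with hAdef
    have hx' : ∀ s ∈ A, hessAt (orbitRep s.2.1) s.2.2.1 s.2.2.2 = hessAt (orbitRep s₀.2.1) s₀.2.2.1 s₀.2.2.2 ∧
        covAt (orbitRep s.2.1) s.2.2.1 s.2.2.2 = covAt (orbitRep s₀.2.1) s₀.2.2.1 s₀.2.2.2 := by
      intro s hs
      obtain ⟨hsU, hΦ⟩ := Finset.mem_filter.mp hs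
      obtain ⟨hmax, hsh⟩ := hmemU s hsU
      obtain ⟨-, h1, h2, -⟩ := hspec _ _ hmax hsh
      have hij : ij (orbitRep s.2.1) s.2.2 = ij (orbitRep s₀.2.1) s₀.2.2 := congrArg Prod.fst hΦ
      have hxc : xc (orbitRep s.2.1) s.2.2 = xc (orbitRep s₀.2.1) s₀.2.2 := congrArg Prod.snd hΦ
      rw [hij, hxc] at h1 h2
      constructor
      · linarith
      · linarith
    have hDO : ∀ s ∈ A, (⟨s.1, s.2.1⟩ : Σ D : ℤ, orbitsOfDisc D) = ⟨s₀.1, s₀.2.1⟩ := by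
      intro s hs
      obtain ⟨hmax, hsh⟩ := hmemU s (Finset.mem_filter.mp hs).1
      exact sigma_eq_of_data hmax hmax₀ hsh.1 hsh₀.1 (hx' s hs).1 (hx' s hs).2
    have hinj : Set.InjOn (fun s : (Σ D : ℤ, Σ _ : orbitsOfDisc D, ℤ × ℤ) => s.2.2) A := by
      intro s hs s' hs' hq
      have h := (hDO s hs).trans (hDO s' hs').symm
      obtain ⟨D, O, q⟩ := s
      obtain ⟨D', O', q'⟩ := s'
      simp only at h hq
      obtain ⟨rfl, hO⟩ := Sigma.mk.inj_iff.mp h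
      have hO' : O = O' := eq_of_heq hO
      subst hO' hq
      rfl
    have hmaps : ∀ s ∈ A, s.2.2 ∈ {q : ℤ × ℤ | hessAt (orbitRep s₀.2.1) q.1 q.2 = hessAt (orbitRep s₀.2.1) s₀.2.2.1 s₀.2.2.2 ∧
        covAt (orbitRep s₀.2.1) q.1 q.2 = covAt (orbitRep s₀.2.1) s₀.2.2.1 s₀.2.2.2} := by
      intro s hs
      have e : orbitRep s.2.1 = orbitRep s₀.2.1 :=
        congrArg (fun p : (Σ D : ℤ, orbitsOfDisc D) => orbitRep p.2) (hDO s hs)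
      have := hx' s hs
      rw [e] at this
      exact this
    obtain ⟨hfin, h27⟩ := ncard_data_le hmax₀ (hessAt (orbitRep s₀.2.1) s₀.2.2.1 s₀.2.2.2)
      (covAt (orbitRep s₀.2.1) s₀.2.2.1 s₀.2.2.2)
    calc A.card = (A : Set _).ncard := (Set.ncard_coe_finset A).symm
      _ ≤ _ := Set.ncard_le_ncard_of_injOn _ (fun s hs => hmaps s hs) hinj hfin
      _ ≤ 27 := h27
  have h1 : U.card ≤ 27 * (U.image Φ).card := Finset.card_le_mul_card_image U 27 hfib
  -- the image lies in the union of the nine shells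
  set L : ℕ × ℕ → ℝ := fun ij => 16 * Y / ((2 : ℝ) ^ ij.1 * 3 ^ ij.2) ^ 12 with hL
  have hsub : U.image Φ ⊆ (Finset.range 3 ×ˢ Finset.range 3).biUnion
      (fun ij => ({ij} : Finset (ℕ × ℕ)) ×ˢ (cuspShell_finite X (L ij)).toFinset) := by
    intro b hb
    obtain ⟨s, hs, rfl⟩ := Finset.mem_image.mp hb
    obtain ⟨hmax, hsh⟩ := hmemU s hs
    obtain ⟨hij, -, -, hx⟩ := hspec _ _ hmax hsh
    refine Finset.mem_biUnion.mpr ⟨_, hij, Finset.mem_product.mpr ⟨Finset.mem_singleton_self _, ?_⟩⟩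
    simpa [Set.Finite.mem_toFinset] using hx
  have h2 : (U.image Φ).card ≤ ∑ ij ∈ Finset.range 3 ×ˢ Finset.range 3, (cuspShell X (L ij)).ncard := by
    refine (Finset.card_le_card hsub).trans (Finset.card_biUnion_le.trans (Finset.sum_le_sum fun ij _ => ?_))
    rw [Finset.card_product, Finset.card_singleton, one_mul, Set.ncard_eq_toFinset_card _ (cuspShell_finite X (L ij))]
  rw [← hU]
  exact h1.trans (Nat.mul_le_mul_left 27 h2)

/-! ## 6. The inverse dictionary `CoreLaw → CoreLawIF` -/

/-- **Per-level bound in the robust region.** If the cusp law holds on `X^{κ₁} ≤ Y' ≤ X^{σ+1}` with constant `C₀`,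
then at a level `L ∈ [Y/c, 16Y]` with `c·X^{κ₁} ≤ Y ≤ X^σ`, `X ≥ 16`:
`#cuspShell X L ≤ max(C₀,0)·16^ε·c^{1/6}·(XY)^ε·(X·Y^{-1/6} + 1)`. -/
theorem level_bound {κ₁ σ ε C₀ c X Y L : ℝ}
    (hC : ∀ X Y : ℝ, 1 ≤ X → 1 ≤ Y → X ^ κ₁ ≤ Y → Y ≤ X ^ (σ + 1) →
      ((cuspShell X Y).ncard : ℝ) ≤ C₀ * (X * Y) ^ ε * (X * Y ^ (-(1 / 6 : ℝ)) + 1))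
    (hε : 0 < ε) (hX : 16 ≤ X) (hY : 1 ≤ Y) (hc : 1 ≤ c) (hcX : c * X ^ κ₁ ≤ Y) (hYσ : Y ≤ X ^ σ)
    (hLlo : Y / c ≤ L) (hLhi : L ≤ 16 * Y) (hκ₁ : 0 ≤ κ₁) :
    ((cuspShell X L).ncard : ℝ) ≤
      max C₀ 0 * (16 : ℝ) ^ ε * c ^ (1 / 6 : ℝ) * (X * Y) ^ ε * (X * Y ^ (-(1 / 6 : ℝ)) + 1) := by
  have hX1 : 1 ≤ X := by linarith
  have hX0 : 0 < X := by linarith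
  have hY0 : 0 < Y := by linarith
  have hc0 : 0 < c := by linarith
  have hXκ : 1 ≤ X ^ κ₁ := Real.one_le_rpow hX1 hκ₁
  have hlo : X ^ κ₁ ≤ L := by
    refine le_trans ?_ hLlo
    rw [le_div_iff₀ hc0]; linarith [mul_comm c (X ^ κ₁)]
  have hL1 : 1 ≤ L := hXκ.trans hlo
  have hL0 : 0 < L := by linarith
  have hhi : L ≤ X ^ (σ + 1) := by
    rw [Real.rpow_add_one hX0.ne' σ]
    have hσ0 : 0 ≤ X ^ σ := Real.rpow_nonneg hX0.le σ
    nlinarith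
  have h := hC X L hX1 hL1 hlo hhi
  -- `(XL)^ε ≤ 16^ε (XY)^ε`
  have hE : (X * L) ^ ε ≤ (16 : ℝ) ^ ε * (X * Y) ^ ε := by
    rw [← Real.mul_rpow (by norm_num) (by positivity)]
    exact Real.rpow_le_rpow (by positivity) (by nlinarith) hε.le
  -- `L^{-1/6} ≤ c^{1/6} Y^{-1/6}`
  have hR : L ^ (-(1 / 6 : ℝ)) ≤ c ^ (1 / 6 : ℝ) * Y ^ (-(1 / 6 : ℝ)) := by
    have h1 : L ^ (-(1 / 6 : ℝ)) ≤ (Y / c) ^ (-(1 / 6 : ℝ)) :=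
      Real.rpow_le_rpow_of_nonpos (by positivity) hLlo (by norm_num)
    have h2 : (Y / c) ^ (-(1 / 6 : ℝ)) = c ^ (1 / 6 : ℝ) * Y ^ (-(1 / 6 : ℝ)) := by
      rw [Real.div_rpow hY0.le hc0.le, Real.rpow_neg hc0.le, div_inv_eq_mul, mul_comm]
    rw [← h2]; exact h1
  have hc6 : 1 ≤ c ^ (1 / 6 : ℝ) := Real.one_le_rpow hc (by norm_num)
  have hB : X * L ^ (-(1 / 6 : ℝ)) + 1 ≤ c ^ (1 / 6 : ℝ) * (X * Y ^ (-(1 / 6 : ℝ)) + 1) := by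
    have h1 : X * L ^ (-(1 / 6 : ℝ)) ≤ X * (c ^ (1 / 6 : ℝ) * Y ^ (-(1 / 6 : ℝ))) := mul_le_mul_of_nonneg_left hR hX0.le
    nlinarith
  have hEpos : 0 ≤ (X * L) ^ ε := Real.rpow_nonneg (by positivity) ε
  have hBpos : 0 ≤ X * L ^ (-(1 / 6 : ℝ)) + 1 := by positivity
  calc ((cuspShell X L).ncard : ℝ) ≤ C₀ * (X * L) ^ ε * (X * L ^ (-(1 / 6 : ℝ)) + 1) := h
    _ ≤ max C₀ 0 * (X * L) ^ ε * (X * L ^ (-(1 / 6 : ℝ)) + 1) :=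
        mul_le_mul_of_nonneg_right (mul_le_mul_of_nonneg_right (le_max_left _ _) hEpos) hBpos
    _ ≤ max C₀ 0 * ((16 : ℝ) ^ ε * (X * Y) ^ ε) * (c ^ (1 / 6 : ℝ) * (X * Y ^ (-(1 / 6 : ℝ)) + 1)) :=
        mul_le_mul (mul_le_mul_of_nonneg_left hE (le_max_right _ _)) hB hBpos (by positivity)
    _ = max C₀ 0 * (16 : ℝ) ^ ε * c ^ (1 / 6 : ℝ) * (X * Y) ^ ε * (X * Y ^ (-(1 / 6 : ℝ)) + 1) := by ring

/-- **The inverse dictionary `CoreLaw → CoreLawIF`** (registered sub-goal of stmt-ABC-1975, stub `stub_ringCensus`):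
the Szpiro-robust cusp core implies the Szpiro-robust index-form core.  Given `3 < κ₀ < σ`, use `CoreLaw` at
`(κ₁, σ + 1)`, `κ₁ = (3 + κ₀)/2`; by `totalCount_le_sum_cuspShell` the index-form count is `≤ 27·Σ` of the nine cusp
shells at the levels `L = 16Y/(2^s3^t)¹² ∈ [Y/c, 16Y]`, `c = 36¹²/16`, which lie in the robust region of
`(κ₁, σ + 1)` as soon as `X ≥ max(c^{1/(κ₀−κ₁)}, 16)` (`level_bound`); for smaller `X` the level `Y ≤ X^σ` is
bounded and so are the shells (`box_finite`). -/
theorem coreLawIF_of_coreLaw : CoreLaw → CoreLawIF := by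
  intro hcore κ₀ σ hκ₀ hκσ ε hε
  obtain ⟨κ₁, hκ₁def⟩ : ∃ κ₁ : ℝ, κ₁ = (3 + κ₀) / 2 := ⟨_, rfl⟩
  have hκ₁3 : 3 < κ₁ := by rw [hκ₁def]; linarith
  have hκ₁κ₀ : κ₁ < κ₀ := by rw [hκ₁def]; linarith
  obtain ⟨C₀, hC₀⟩ := hcore κ₁ (σ + 1) hκ₁3 (by linarith) ε hε
  obtain ⟨c, hcdef⟩ : ∃ c : ℝ, c = (36 : ℝ) ^ 12 / 16 := ⟨_, rfl⟩
  have hc1 : 1 ≤ c := by rw [hcdef]; norm_num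
  obtain ⟨δ, hδ⟩ : ∃ δ : ℝ, δ = κ₀ - κ₁ := ⟨_, rfl⟩
  have hδ0 : 0 < δ := by rw [hδ]; linarith
  obtain ⟨X₂, hX₂⟩ : ∃ X₂ : ℝ, X₂ = max (c ^ (1 / δ)) 16 := ⟨_, rfl⟩
  have hX₂16 : 16 ≤ X₂ := by rw [hX₂]; exact le_max_right _ _
  obtain ⟨Y₀, hY₀⟩ : ∃ Y₀ : ℝ, Y₀ = X₂ ^ σ := ⟨_, rfl⟩
  obtain ⟨K, hK⟩ : ∃ K : ℕ, K = {x : ℤ × ℤ | (1728 : ℤ) ∣ x.1 ^ 3 - x.2 ^ 2 ∧ (Mcusp x : ℝ) < 32 * Y₀}.ncard := ⟨_, rfl⟩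
  obtain ⟨C₁, hC₁⟩ : ∃ C₁ : ℝ, C₁ = max C₀ 0 * (16 : ℝ) ^ ε * c ^ (1 / 6 : ℝ) := ⟨_, rfl⟩
  have hC₁0 : 0 ≤ C₁ := by rw [hC₁]; positivity
  refine ⟨243 * K + 243 * C₁, fun X Y hX hY hlo hhi => ?_⟩
  have hX0 : 0 < X := by linarith
  have hσ0 : 0 < σ := by linarith
  have htot : (totalCount (fun _ _ _ _ => True) X Y : ℝ) ≤
      27 * ∑ ij ∈ Finset.range 3 ×ˢ Finset.range 3,
        ((cuspShell X (16 * Y / ((2 : ℝ) ^ ij.1 * 3 ^ ij.2) ^ 12)).ncard : ℝ) := by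
    exact_mod_cast totalCount_le_sum_cuspShell X Y
  have hcard9 : (Finset.range 3 ×ˢ Finset.range 3).card = 9 := by simp
  have hXYε : 1 ≤ (X * Y) ^ ε := Real.one_le_rpow (by nlinarith) hε.le
  have hB1 : 1 ≤ X * Y ^ (-(1 / 6 : ℝ)) + 1 := by
    have : 0 ≤ X * Y ^ (-(1 / 6 : ℝ)) := by positivity
    linarith
  -- the nine levels
  have hkk : ∀ ij ∈ Finset.range 3 ×ˢ Finset.range 3,
      1 ≤ ((2 : ℝ) ^ ij.1 * 3 ^ ij.2) ^ 12 ∧ ((2 : ℝ) ^ ij.1 * 3 ^ ij.2) ^ 12 ≤ (36 : ℝ) ^ 12 := by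
    intro ij hij
    obtain ⟨hi, hj⟩ := Finset.mem_product.mp hij
    have hi : ij.1 ≤ 2 := by have := Finset.mem_range.mp hi; omega
    have hj : ij.2 ≤ 2 := by have := Finset.mem_range.mp hj; omega
    have h1 : (1 : ℝ) ≤ 2 ^ ij.1 * 3 ^ ij.2 :=
      one_le_mul_of_one_le_of_one_le (one_le_pow₀ (by norm_num)) (one_le_pow₀ (by norm_num))
    have h2 : (2 : ℝ) ^ ij.1 * 3 ^ ij.2 ≤ 36 := by
      have h2a : (2 : ℝ) ^ ij.1 ≤ 2 ^ 2 := pow_le_pow_right₀ (by norm_num) hi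
      have h3a : (3 : ℝ) ^ ij.2 ≤ 3 ^ 2 := pow_le_pow_right₀ (by norm_num) hj
      nlinarith [pow_nonneg (by norm_num : (0 : ℝ) ≤ 2) ij.1, pow_nonneg (by norm_num : (0 : ℝ) ≤ 3) ij.2]
    exact ⟨one_le_pow₀ h1, pow_le_pow_left₀ (by linarith) h2 12⟩
  have hLhi : ∀ ij ∈ Finset.range 3 ×ˢ Finset.range 3, 16 * Y / ((2 : ℝ) ^ ij.1 * 3 ^ ij.2) ^ 12 ≤ 16 * Y :=
    fun ij hij => div_le_self (by linarith) (hkk ij hij).1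
  have hLlo : ∀ ij ∈ Finset.range 3 ×ˢ Finset.range 3, Y / c ≤ 16 * Y / ((2 : ℝ) ^ ij.1 * 3 ^ ij.2) ^ 12 := by
    intro ij hij
    rw [hcdef, show Y / ((36 : ℝ) ^ 12 / 16) = 16 * Y / 36 ^ 12 by field_simp]
    exact div_le_div_of_nonneg_left (by linarith) (by linarith [(hkk ij hij).1]) (hkk ij hij).2
  by_cases hXs : X < X₂
  · -- bounded region: `Y ≤ X₂^σ`, every shell inside the finite box of level `32·Y₀`
    have hYY₀ : Y ≤ Y₀ := by rw [hY₀]; exact hhi.trans (Real.rpow_le_rpow hX0.le hXs.le hσ0.le)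
    have hshell : ∀ ij ∈ Finset.range 3 ×ˢ Finset.range 3,
        ((cuspShell X (16 * Y / ((2 : ℝ) ^ ij.1 * 3 ^ ij.2) ^ 12)).ncard : ℝ) ≤ K := by
      intro ij hij
      have hsub : cuspShell X (16 * Y / ((2 : ℝ) ^ ij.1 * 3 ^ ij.2) ^ 12) ⊆
          {x : ℤ × ℤ | (1728 : ℤ) ∣ x.1 ^ 3 - x.2 ^ 2 ∧ (Mcusp x : ℝ) < 32 * Y₀} := by
        rintro x ⟨-, -, -, hdvd, -, -, hM, -⟩
        exact ⟨hdvd, by linarith [hLhi ij hij]⟩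
      rw [hK]; exact_mod_cast Set.ncard_le_ncard hsub (box_finite _)
    have hsum : ∑ ij ∈ Finset.range 3 ×ˢ Finset.range 3,
        ((cuspShell X (16 * Y / ((2 : ℝ) ^ ij.1 * 3 ^ ij.2) ^ 12)).ncard : ℝ) ≤ 9 * K := by
      have := Finset.sum_le_card_nsmul _ _ _ hshell
      rw [hcard9] at this; simpa using this
    calc (totalCount (fun _ _ _ _ => True) X Y : ℝ) ≤ 27 * (9 * K) := htot.trans (by linarith)
      _ = (243 * K) * 1 * 1 := by ring
      _ ≤ (243 * K + 243 * C₁) * (X * Y) ^ ε * (X * Y ^ (-(1 / 6 : ℝ)) + 1) :=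
        mul_le_mul (mul_le_mul (by linarith) hXYε zero_le_one (by positivity)) hB1 zero_le_one (by positivity)
  · -- robust region
    push Not at hXs
    have hX16 : 16 ≤ X := hX₂16.trans hXs
    have hcX : c * X ^ κ₁ ≤ Y := by
      have hXδ : c ≤ X ^ δ := by
        have h1 : c ^ (1 / δ) ≤ X := le_trans (by rw [hX₂]; exact le_max_left _ _) hXs
        have h2 : (c ^ (1 / δ)) ^ δ = c := by
          rw [← Real.rpow_mul (by linarith), one_div_mul_cancel hδ0.ne', Real.rpow_one]
        rw [← h2]; exact Real.rpow_le_rpow (by positivity) h1 hδ0.le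
      calc c * X ^ κ₁ ≤ X ^ δ * X ^ κ₁ := mul_le_mul_of_nonneg_right hXδ (Real.rpow_nonneg hX0.le _)
        _ = X ^ κ₀ := by rw [← Real.rpow_add hX0, show δ + κ₁ = κ₀ by rw [hδ]; ring]
        _ ≤ Y := hlo
    have hshell : ∀ ij ∈ Finset.range 3 ×ˢ Finset.range 3,
        ((cuspShell X (16 * Y / ((2 : ℝ) ^ ij.1 * 3 ^ ij.2) ^ 12)).ncard : ℝ) ≤
          C₁ * (X * Y) ^ ε * (X * Y ^ (-(1 / 6 : ℝ)) + 1) := by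
      intro ij hij
      rw [hC₁]
      exact level_bound hC₀ hε hX16 hY hc1 hcX hhi (hLlo ij hij) (hLhi ij hij) (by linarith)
    have hsum : ∑ ij ∈ Finset.range 3 ×ˢ Finset.range 3,
        ((cuspShell X (16 * Y / ((2 : ℝ) ^ ij.1 * 3 ^ ij.2) ^ 12)).ncard : ℝ) ≤
          9 * (C₁ * (X * Y) ^ ε * (X * Y ^ (-(1 / 6 : ℝ)) + 1)) := by
      have := Finset.sum_le_card_nsmul _ _ _ hshell
      rw [hcard9] at this; simpa using this
    have hK0 : (0 : ℝ) ≤ 243 * K := by positivity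
    calc (totalCount (fun _ _ _ _ => True) X Y : ℝ)
        ≤ 27 * (9 * (C₁ * (X * Y) ^ ε * (X * Y ^ (-(1 / 6 : ℝ)) + 1))) := htot.trans (by linarith)
      _ = 243 * C₁ * (X * Y) ^ ε * (X * Y ^ (-(1 / 6 : ℝ)) + 1) := by ring
      _ ≤ (243 * K + 243 * C₁) * (X * Y) ^ ε * (X * Y ^ (-(1 / 6 : ℝ)) + 1) :=
        mul_le_mul_of_nonneg_right (mul_le_mul_of_nonneg_right (by linarith) (by positivity)) (by positivity)

end Summit.ABC.ABC.Theorems.SharpModerateLaw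

end
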